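import Literature.AlgebraicGeometry.Morphisms.SectionsBaseChangeOfFibreVanishingPoints
import Literature.AlgebraicGeometry.Morphisms.ProjectiveOfFibreSpan
import HarnessLib

/-!
# `H⁰` base change ⇒ the restricted global sections span: the adapter between the two halves of the (h2) chain

Topic `AlgebraicGeometry/Morphisms`; namespace `Literature.AlgebraicGeometry.Morphisms`. THEOREMS ONLY (no definition, no named
fact, no instance, no `sorry`).

The «cohomology and base change in degree `0`» half of the (h2) chain (★ `Morphisms/SectionsBaseChangeOfFibrewiseVanishing`
(G8), ★ `…Charts` (G9), ★ `…Points`; B-p19/B-p04) concludes, for a cartesian square `X′ = X ×_A B′` (`k : X′ → X`,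
`g′ : X′ → B′`, `j : B′ → Spec A`), with a linear EQUIVALENCE `Γ(B′, 𝒪) ⊗_{Γ(Spec A, 𝒪)} Γ(X, G) ≃ Γ(X′, k^*G)`,
`b ⊗ t ↦ b · η(t)`. The «fibrewise very ample ⇒ projective» half (★ `Morphisms/ProjectiveOfFibreSpan`, B-p20) consumes
the statement «the restrictions `η(b_j)` of a spanning family `b` of `Γ(X, G)` SPAN the fibre sections over `Γ(B′, 𝒪)`».
This file is the adapter:

* §1 `span_range_eq_top_of_tensor_surjective` — pure algebra: a `B`-linear SURJECTION `B ⊗_R M → N`, `b ⊗ t ↦ b · η(t)`,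
  forces `span_B (range η) = N`.
* §2 for ANY square `H : IsPullback k g′ p j` over `Spec A` (any ring `A`, any scheme `B′`): `unitSectionLE_toSections_smul`
  (`η` is semilinear over `j♯`), `span_range_unitSectionLE_eq_top_of_exists_linearEquiv` (the G8/G9 conclusion ⇒ the `η(t)`
  span), `span_range_unitSectionLE_comp_eq_top_of_span` (⇒ so do the `η(b_j)` for any family `b` spanning `Γ(X, G)` over
  `Γ(Spec A, 𝒪)`).
* §3 joins by name: `span_range_unitSectionLE_comp_eq_top_of_forall_fiber` (★ `exists_tensor_secMod_top_linearEquiv_of_forall_fiber`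
  ⇒ §2, any affine `B′`) and `isClosedImmersion_toProj_comap_of_forall_fiber_of_span` (⇒ ★ `isClosedImmersion_toProj_comap_of_span`
  at `B′ = Spec κ(𝔭)`: under `Ext¹ = 0` on ALL fibres, a fibre embedded by its own sections is embedded by the restricted `b_j`).

Cell `hodgecm-mathlib`, F-DAG (h2) (B-p20 (g11), B-plan1 (g16) (p1)); count-neutral (HC_CM is proved only modulo the 7 printed
citations until rung 0 closes).

## References
* D. Mumford, *Abelian Varieties* (1970), §5 Cor. 3 (p. 53). [MumfordAV1970]
* R. Hartshorne, *Algebraic Geometry* (1977), III Thm. 12.11 (p. 290); II Thm. 7.1. [Hartshorne1977]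
* A. Grothendieck, J. Dieudonné, *EGA III₁* (1961), Thm. 4.7.1. [EGAIII1]
-/

noncomputable section

-- `TopCat.Presheaf`/`Scheme.Modules` bookkeeping (as in ★ `Morphisms/ProjectiveOfFibreSpan`).
set_option backward.isDefEq.respectTransparency false

universe u

open CategoryTheory CategoryTheory.Limits CategoryTheory.Abelian AlgebraicGeometry TopologicalSpace Opposite
open TensorProduct
open Literature.AlgebraicGeometry.Modules
open Literature.AlgebraicGeometry.Motives Literature.AlgebraicGeometry.Motives.GeneratingSections

namespace Literature.AlgebraicGeometry.Morphisms

/-! ## §1 Algebra: a surjection `B ⊗_R M → N`, `b ⊗ t ↦ b · η(t)`, makes the `η(t)` span -/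

/-- **If `b ⊗ t ↦ b · η(t)` extends to a `B`-linear SURJECTION `B ⊗_R M → N`, then the `η(t)` span `N` over `B`** (every
element of `B ⊗_R M` is a sum of pure tensors). [cite: Hartshorne1977, III Thm. 12.11 (p. 290)] -/
theorem span_range_eq_top_of_tensor_surjective {R B M N : Type*} [CommSemiring R] [CommSemiring B] [Algebra R B]
    [AddCommMonoid M] [Module R M] [AddCommMonoid N] [Module B N] (η : M → N) (F : B ⊗[R] M →ₗ[B] N)
    (hF : ∀ (b : B) (t : M), F (b ⊗ₜ t) = b • η t) (hsurj : Function.Surjective F) :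
    Submodule.span B (Set.range η) = ⊤ := by
  have key : ∀ x, F x ∈ Submodule.span B (Set.range η) := fun x ↦ by
    induction x using TensorProduct.induction_on with
    | zero => rw [map_zero]; exact Submodule.zero_mem _
    | tmul b t => rw [hF]; exact Submodule.smul_mem _ _ (Submodule.subset_span ⟨t, rfl⟩)
    | add x y hx hy => rw [map_add]; exact Submodule.add_mem _ hx hy
  exact eq_top_iff.mpr fun n _ ↦ by
    obtain ⟨x, rfl⟩ := hsurj n
    exact key x

/-! ## §2 Any cartesian square over `Spec A` -/

section Square

variable {A : Type u} [CommRing A] {X X' B' : Scheme.{u}} {p : X ⟶ Spec (.of A)} {g' : X' ⟶ B'} {k : X' ⟶ X}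
  {j : B' ⟶ Spec (.of A)} (H : IsPullback k g' p j) (G : X.Modules)

/-- Restriction of `𝒪_Y(Y)` along `⊤ ≤ ⊤` is the identity. [folklore] -/
private theorem sbc_map_top (Y : Scheme.{u}) (y : Γ(Y, ⊤)) :
    Y.presheaf.map (homOfLE (le_top : (⊤ : Y.Opens) ≤ ⊤)).op y = y := by
  have h : (homOfLE (le_top : (⊤ : Y.Opens) ≤ ⊤)) = 𝟙 _ := Subsingleton.elim _ _
  rw [h, op_id]
  erw [CategoryTheory.Functor.map_id]
  rfl

include H in
/-- **`η` is semilinear over the ring square**: `η(p♯(a) · u) = g′♯(j♯(a)) · η(u)` for `a ∈ Γ(Spec A, 𝒪)`, `u ∈ Γ(X, G)`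
(`k♯ ∘ p♯ = g′♯ ∘ j♯`). [cite: Hartshorne1977, II.5 (p. 110)] -/
theorem unitSectionLE_toSections_smul (a : Γ(Spec (.of A), ⊤)) (u : Γ(G, ⊤)) :
    unitSectionLE k G (V := ⊤) (U := ⊤) le_top (toSections p.appTop.hom ⊤ a • u) =
      toSections g'.appTop.hom ⊤ (j.appTop a) • unitSectionLE k G (V := ⊤) (U := ⊤) le_top u := by
  rw [unitSectionLE_smul]
  congr 1
  rw [toSections, toSections, RingHom.comp_apply, RingHom.comp_apply, sbc_map_top, sbc_map_top, appLE_top_top]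
  change (p.appTop ≫ k.appTop) a = (j.appTop ≫ g'.appTop) a
  rw [← Scheme.Hom.comp_appTop, ← Scheme.Hom.comp_appTop, H.w]

/-- **The `H⁰` base-change equivalence makes the restricted global sections span**: if some `Γ(B′, 𝒪)`-linear
`E : Γ(B′, 𝒪) ⊗ Γ(X, G) ≃ Γ(X′, k^*G)` has `E (b ⊗ t) = b · η(t)` (the conclusion of ★
`exists_tensor_secMod_top_linearEquiv_of_forall_prime` / `_of_forall_fiber`), then the `η(t)`, `t ∈ Γ(X, G)`, span `Γ(X′, k^*G)`
over `Γ(B′, 𝒪)`. [cite: MumfordAV1970, §5 Cor. 3 (p. 53)] [cite: Hartshorne1977, III Thm. 12.11 (p. 290)] -/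
theorem span_range_unitSectionLE_eq_top_of_exists_linearEquiv [Algebra Γ(Spec (.of A), ⊤) Γ(B', ⊤)]
    (hE : ∃ E : Γ(B', ⊤) ⊗[Γ(Spec (.of A), ⊤)] SecMod G p.appTop.hom ⊤ ≃ₗ[Γ(B', ⊤)]
        SecMod ((Scheme.Modules.pullback k).obj G) g'.appTop.hom ⊤,
      ∀ (b : Γ(B', ⊤)) (t : SecMod G p.appTop.hom ⊤),
        E (b ⊗ₜ t) = b • SecMod.mk (ρ := g'.appTop.hom) (unitSectionLE k G (V := ⊤) (U := ⊤) le_top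
          (SecMod.val (L := G) (ρ := p.appTop.hom) t))) :
    Submodule.span Γ(B', ⊤) (Set.range fun t : SecMod G p.appTop.hom ⊤ ↦
      SecMod.mk (L := (Scheme.Modules.pullback k).obj G) (ρ := g'.appTop.hom) (U := ⊤)
        (unitSectionLE k G (V := ⊤) (U := ⊤) le_top (SecMod.val (L := G) (ρ := p.appTop.hom) t))) = ⊤ := by
  obtain ⟨E, hE⟩ := hE
  exact span_range_eq_top_of_tensor_surjective _ E.toLinearMap hE E.surjective

include H in
/-- **Hence the restrictions of ANY spanning family span**: if `b : ι → Γ(X, G)` spans `Γ(X, G)` over `Γ(Spec A, 𝒪)` and the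
`η(t)` span `Γ(X′, k^*G)` over `Γ(B′, 𝒪)`, so do the `η(b_i)` — the `hs` hypothesis of ★
`isClosedImmersion_toProj_comap_of_span` for every family of fibre sections. [cite: Hartshorne1977, II Thm. 7.1] -/
theorem span_range_unitSectionLE_comp_eq_top_of_span {ι : Type*} [Fintype ι] (b : ι → Γ(G, ⊤))
    (hb : Submodule.span Γ(Spec (.of A), ⊤) (Set.range fun i ↦ SecMod.mk (L := G) (ρ := p.appTop.hom) (U := ⊤) (b i)) = ⊤)
    (hspan : Submodule.span Γ(B', ⊤) (Set.range fun t : SecMod G p.appTop.hom ⊤ ↦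
      SecMod.mk (L := (Scheme.Modules.pullback k).obj G) (ρ := g'.appTop.hom) (U := ⊤)
        (unitSectionLE k G (V := ⊤) (U := ⊤) le_top (SecMod.val (L := G) (ρ := p.appTop.hom) t))) = ⊤) :
    Submodule.span Γ(B', ⊤) (Set.range fun i ↦
      SecMod.mk (L := (Scheme.Modules.pullback k).obj G) (ρ := g'.appTop.hom) (U := ⊤)
        (unitSectionLE k G (V := ⊤) (U := ⊤) le_top (b i))) = ⊤ := by
  classical
  let E₀ : X'.Modules := (Scheme.Modules.pullback k).obj G
  let η : Γ(G, ⊤) → Γ(E₀, ⊤) := fun u ↦ unitSectionLE k G (V := ⊤) (U := ⊤) le_top u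
  have hηadd : ∀ u v, η (u + v) = η u + η v := fun u v ↦ unitSectionLE_add k G le_top u v
  rw [eq_top_iff, ← hspan, Submodule.span_le]
  rintro _ ⟨u, rfl⟩
  obtain ⟨c, hc⟩ := Finsupp.mem_span_range_iff_exists_finsupp.mp
    (show u ∈ Submodule.span Γ(Spec (.of A), ⊤) (Set.range fun i ↦ SecMod.mk (L := G) (ρ := p.appTop.hom) (U := ⊤) (b i))
      by rw [hb]; exact Submodule.mem_top)
  have ha : ∑ i, c i • SecMod.mk (L := G) (ρ := p.appTop.hom) (U := ⊤) (b i) = u := by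
    rw [← hc, Finsupp.sum_fintype c (fun i a ↦ a • SecMod.mk (L := G) (ρ := p.appTop.hom) (U := ⊤) (b i))
      (fun i ↦ zero_smul _ _)]
  rw [← ha]
  beta_reduce
  let ηh : Γ(G, ⊤) →+ Γ(E₀, ⊤) := AddMonoidHom.mk' η hηadd
  have hval : SecMod.val (L := G) (ρ := p.appTop.hom)
      (∑ i, c i • SecMod.mk (L := G) (ρ := p.appTop.hom) (U := ⊤) (b i)) =
      ∑ i, toSections p.appTop.hom ⊤ (c i) • b i := by
    induction (Finset.univ : Finset ι) using Finset.induction_on with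
    | empty => rfl
    | insert j T hj ih => rw [Finset.sum_insert hj, Finset.sum_insert hj, SecMod.val_add, ih]; rfl
  have hη : η (∑ i, toSections p.appTop.hom ⊤ (c i) • b i) =
      ∑ i, toSections g'.appTop.hom ⊤ (j.appTop (c i)) • η (b i) := by
    change ηh _ = _
    rw [map_sum]
    exact Finset.sum_congr rfl fun i _ ↦ unitSectionLE_toSections_smul H G (c i) (b i)
  have hmk : SecMod.mk (L := E₀) (ρ := g'.appTop.hom) (U := ⊤)
      (unitSectionLE k G le_top (SecMod.val (L := G) (ρ := p.appTop.hom)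
        (∑ i, c i • SecMod.mk (L := G) (ρ := p.appTop.hom) (U := ⊤) (b i)))) =
      ∑ i, j.appTop (c i) • SecMod.mk (L := E₀) (ρ := g'.appTop.hom) (U := ⊤) (η (b i)) := by
    rw [hval]
    change SecMod.mk (η _) = _
    rw [hη]
    induction (Finset.univ : Finset ι) using Finset.induction_on with
    | empty => rfl
    | insert i T hi ih =>
      rw [Finset.sum_insert hi, Finset.sum_insert hi, ← ih]
      rfl
  rw [hmk]
  exact Submodule.sum_mem _ fun i _ ↦ Submodule.smul_mem _ _ (Submodule.subset_span ⟨i, rfl⟩)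

end Square

/-! ## §3 Joins by name -/

section ForallFiber

variable {A : Type} [CommRing A] [IsNoetherianRing A] {X : Scheme.{0}} (p : X ⟶ Spec (CommRingCat.of A)) [IsProper p] [Flat p]
  (G : X.Modules) (hL : IsFiniteLocallyFree G)
  (hvan : ∀ y : Spec (CommRingCat.of A),
    Subsingleton (Ext.{1} (unitModule (p.fiber y)) ((Scheme.Modules.pullback (p.fiberι y)).obj G) 1))
  {X' B' : Scheme.{0}} [IsAffine B'] {g' : X' ⟶ B'} {k : X' ⟶ X} {j : B' ⟶ Spec (CommRingCat.of A)}
  (H : IsPullback k g' p j)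

include hL hvan H in
/-- **`Ext¹ = 0` on every fibre ⇒ the restrictions of a spanning family span, after ANY affine base change** (★
`exists_tensor_secMod_top_linearEquiv_of_forall_fiber` ⇒ §2). [cite: MumfordAV1970, §5 Cor. 3 (p. 53)]
[cite: Hartshorne1977, III Thm. 12.11 (p. 290)] -/
theorem span_range_unitSectionLE_comp_eq_top_of_forall_fiber {ι : Type*} [Fintype ι] (b : ι → Γ(G, ⊤))
    (hb : Submodule.span Γ(Spec (CommRingCat.of A), ⊤)
      (Set.range fun i ↦ SecMod.mk (L := G) (ρ := p.appTop.hom) (U := ⊤) (b i)) = ⊤) :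
    Submodule.span Γ(B', ⊤) (Set.range fun i ↦
      SecMod.mk (L := (Scheme.Modules.pullback k).obj G) (ρ := g'.appTop.hom) (U := ⊤)
        (unitSectionLE k G (V := ⊤) (U := ⊤) le_top (b i))) = ⊤ := by
  letI := (j.appLE ⊤ ⊤ le_top).hom.toAlgebra
  exact span_range_unitSectionLE_comp_eq_top_of_span H G b hb
    (span_range_unitSectionLE_eq_top_of_exists_linearEquiv G
      (exists_tensor_secMod_top_linearEquiv_of_forall_fiber p G hL hvan H).1)

end ForallFiber

section Embedding

variable {A : Type} [CommRing A] [IsNoetherianRing A] {n m : ℕ} {X : Scheme.{0}} (p : X ⟶ Spec (CommRingCat.of A))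
  [IsProper p] [Flat p] (𝔭 : PrimeSpectrum A)
  {X₀ : Scheme.{0}} {iX : X₀ ⟶ X} {f₀ : X₀ ⟶ Spec (CommRingCat.of 𝔭.asIdeal.ResidueField)}
  (HX : IsPullback iX f₀ p (Spec.map (CommRingCat.ofHom (algebraMap A 𝔭.asIdeal.ResidueField))))
  {E : X.Modules} (F : FrameSystem E) (h1 : ∀ x, F.rank x = 1)
  (hvan : ∀ y : Spec (CommRingCat.of A),
    Subsingleton (Ext.{1} (unitModule (p.fiber y)) ((Scheme.Modules.pullback (p.fiberι y)).obj E) 1))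
  (h1₀ : ∀ x, (F.pullback iX).rank x = 1)
  (s : Fin (n + 1) → Γ((Scheme.Modules.pullback iX).obj E, ⊤))
  (hcov : ⨆ i, ⨆ x, X₀.basicOpen ((CocycleSections.ofFrameSystem (F.pullback iX) h1₀ s).coeff i x) = ⊤)
  (Hs : IsClosedImmersion ((ofCocycleSections (F.pullback iX).U
    (CocycleSections.ofFrameSystem (F.pullback iX) h1₀ s) hcov).toProj f₀))
  (b : Fin (m + 1) → Γ(E, ⊤))
  (hb : Submodule.span Γ(Spec (CommRingCat.of A), ⊤)
    (Set.range fun j ↦ SecMod.mk (L := E) (ρ := p.appTop.hom) (U := ⊤) (b j)) = ⊤)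

include HX hvan Hs hb in
/-- **The two halves joined by name**: `p : X → Spec A` proper flat, `A` noetherian, `E` with a rank-one frame system,
`Ext¹(𝒪, E|_{X_y}) = 0` on EVERY scheme-theoretic fibre, `b` a spanning family of `Γ(X, E)`; then a fibre `X₀ = X ×_A κ(𝔭)` (any
presentation) embedded by its own sections is embedded by the restricted `b_j`, which also generate along the fibre
(★ `exists_tensor_secMod_top_linearEquiv_of_forall_fiber` ⇒ §2 ⇒ ★ `isClosedImmersion_toProj_comap_of_span`).
[cite: EGAIII1, Thm. 4.7.1] [cite: MumfordAV1970, §5 Cor. 3 (p. 53)] -/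
theorem isClosedImmersion_toProj_comap_of_forall_fiber_of_span :
    (∀ y : X₀, ∃ j, iX y ∈ X.basicOpen (GeneratingSections.coeffAt F h1 b j (iX y))) ∧
      ∃ hcov₀ : ⨆ j, ⨆ a, X₀.basicOpen (((CocycleSections.ofFrameSystem F h1 b).comap iX).coeff j a) = ⊤,
        IsClosedImmersion ((GeneratingSections.ofCocycleSections (fun a => iX ⁻¹ᵁ F.U a)
          ((CocycleSections.ofFrameSystem F h1 b).comap iX) hcov₀).toProj f₀) := by
  haveI : IsProper f₀ := MorphismProperty.of_isPullback HX inferInstance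
  have hspan := span_range_unitSectionLE_comp_eq_top_of_forall_fiber p E F.isFiniteLocallyFree hvan HX b hb
  exact isClosedImmersion_toProj_comap_of_span iX f₀ F h1 h1₀ s hcov Hs b fun i ↦ by
    rw [hspan]; exact Submodule.mem_top

end Embedding

end Literature.AlgebraicGeometry.Morphisms
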